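import Literature.MathematicalPhysics.QuantumFieldTheory.Balaban1983to89.Beta.CompositionSingular

/-!
# `BalabanUV.Beta.FP.ConstrainedWoodbury` — road «FP» for binder row D1, row H′2-WOOD-MODEL (R-FP-17): TWO-STAGE WOODBURY FOR THE
# CONSTRAINED COVARIANCE WITH A FINITE-RANK DEFICIT — `flucCov (H − EᵀE) Q = Γ₀ + Γ₀Eᵀ(1 − EΓ₀Eᵀ)⁻¹EΓ₀`, `Γ₀ = flucCov H Q`, under the
# bordered hypothesis `IsUnit (kkt H Q).det` ONLY (no invertibility of `H`) and `IsUnit (1 − EΓ₀Eᵀ).det`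

HONEST DEPENDENCY (page 1, mandatory): continuum YM on T⁴ ⇐ BetaPertH ∧ nine spine estimates (0/9 proved); BetaPertH ⇐ (D1) ∧ (D4) ∧
CAP+tail; G-an2-4 gates asym, D1 and NE2/3/4.  HONEST FRAMING (cell contract, verbatim): «discharging `BetaPertH` makes Bałaban's UV
stability UNCONDITIONAL — a real constructive-QFT result; it is NOT the continuum limit and NOT the Clay problem.»  THIS MODULE is [folklore]
finite-dimensional linear algebra over a field (Mathlib matrices + b12's `CompositionSingular` bordered-inverse dictionary `kkt`/`flucCov`/`minOp`/
`minOpL`/`effForm`); it asserts nothing about Bałaban's objects, cites nothing, mints no `Prop` fact, no `def`; 0 `sorry`.  On road FP (R-FP-17 (H′2))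
it is the MODEL of the two Woodbury steps `Γ^{cov}_n = P^{BF} − R_n^{Q} − R_n^{g}` off the unconstrained perfect propagator; the scale-`n` smoothness of
the remainders (row H′2-IR) is the OWNER's analytic business and is NOT here.  NOT H′2-IR, NOT hasym, NOT D1, NOT BetaPertH, NOT continuum, NOT Clay.

ABSOLUTE RULE (cell charter, verbatim): «No internally-minted statement may enter as a cited fact. Every hypothesis is either kernel-proved in this
package or a verbatim quotation of a PUBLISHED theorem with page reference. The manuscript(s) under audit are NOT citable for their own disputed
steps — they are the thing under adjudication; programme-internal (2001/route/tribunal) claims are never citable.»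

WHAT IS HERE.
* §1 `woodbury_downdate_mul` ∕ `isUnit_det_downdate` ∕ `inv_downdate` (+ the UPDATE twins `woodbury_update_mul` ∕ `inv_update`) — the generic rank-deficit DOWNDATE of an invertible square matrix `K` by `UᵀU`
  (`U` rectangular): if `1 − U K⁻¹ Uᵀ` is invertible then so is `K − UᵀU` and `(K − UᵀU)⁻¹ = K⁻¹ + K⁻¹Uᵀ(1 − UK⁻¹Uᵀ)⁻¹UK⁻¹`.
* §2 the bordered application with `K := kkt H Q`, `Û := fromCols E 0`: `kkt_downdate_eq`, `lift_mul_kktInv_mul_lift_transpose` (`ÛK⁻¹Ûᵀ = E·Γ₀·Eᵀ`),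
  **`isUnit_det_kkt_downdate`**, **`flucCov_downdate`** (the displayed formula), `minOp_downdate` (the minimiser `ℋ₁ = ℋ + Γ₀Eᵀ(1 − EΓ₀Eᵀ)⁻¹Eℋ`),
  `mul_flucCov_downdate` (`Q·Γ₁ = 0`), `flucCov_downdate_transpose` (symmetry for symmetric `H`), `flucCov_downdate_eq_constrProp` (the
  `constrProp` dictionary `Γ₀ = H⁻¹ − H⁻¹Qᵀ(QH⁻¹Qᵀ)⁻¹QH⁻¹` for invertible `H`), `flucCov_update` (the UPDATE sign `H + EᵀE`:
  `Γ₀ − Γ₀Eᵀ(1 + EΓ₀Eᵀ)⁻¹EΓ₀`).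
* §3 `flucCov_downdate_twice` — the TWO-STAGE form (`E_C` then `E_g`) as a corollary.
Provenance: D1 formalisation swarm, unit b2b-balaban-beta-d1-formalise-leaf-05 gen 8 (prover-b2b-balaban-beta-d1-formalise-leaf-05-g8-0), 2026-08-20.
-/

namespace Summit.QuantumFields.BalabanUV.Beta.FP.ConstrainedWoodbury

open scoped Matrix
open Matrix
open Literature.MathematicalPhysics.QuantumFieldTheory.Balaban1983to89.Beta.Composition (kkt blockProp det_kkt_ne_zero)
open Literature.MathematicalPhysics.QuantumFieldTheory.Balaban1983to89.Beta.Envelope (constrProp)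
open Literature.MathematicalPhysics.QuantumFieldTheory.Balaban1983to89.Beta.CompositionSingular (flucCov minOp minOpL effForm
  kktInv_eq_fromBlocks kkt_eq_fromBlocks mul_flucCov flucCov_mul_transpose flucCov_eq_constrProp)

variable {𝕜 : Type*} [Field 𝕜]
variable {ι κ ν μ : Type*} [Fintype ι] [Fintype κ] [Fintype ν] [Fintype μ] [DecidableEq ι] [DecidableEq κ] [DecidableEq ν] [DecidableEq μ]

/-! ## §1 The generic rank-deficit downdate `K − UᵀU` -/

/-- [folklore] **WOODBURY, DOWNDATE FORM (right inverse)**: for invertible `K : Matrix ι ι 𝕜`, `U : Matrix κ ι 𝕜` with `1 − UK⁻¹Uᵀ` invertible,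
`(K − UᵀU)·(K⁻¹ + K⁻¹Uᵀ(1 − UK⁻¹Uᵀ)⁻¹UK⁻¹) = 1`. -/
theorem woodbury_downdate_mul (K : Matrix ι ι 𝕜) (U : Matrix κ ι 𝕜) (hK : IsUnit K.det)
    (hM : IsUnit (1 - U * K⁻¹ * Uᵀ).det) :
    (K - Uᵀ * U) * (K⁻¹ + K⁻¹ * Uᵀ * (1 - U * K⁻¹ * Uᵀ)⁻¹ * U * K⁻¹) = 1 := by
  set Ki := K⁻¹ with hKi
  set S : Matrix κ κ 𝕜 := U * Ki * Uᵀ with hS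
  set M : Matrix κ κ 𝕜 := (1 - S)⁻¹ with hMdef
  have hKKi : K * Ki = 1 := Matrix.mul_nonsing_inv K hK
  have hSM : (1 - S) * M = 1 := Matrix.mul_nonsing_inv _ hM
  have key : M - S * M = 1 := by rw [← hSM, Matrix.sub_mul, Matrix.one_mul]
  -- expand, right-associated
  have e1 : (K - Uᵀ * U) * Ki = 1 - Uᵀ * (U * Ki) := by rw [Matrix.sub_mul, hKKi, Matrix.mul_assoc]
  have e2 : (K - Uᵀ * U) * (Ki * Uᵀ * M * U * Ki) = Uᵀ * (M * (U * Ki)) - Uᵀ * (S * (M * (U * Ki))) := by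
    rw [Matrix.sub_mul]
    congr 1
    · calc K * (Ki * Uᵀ * M * U * Ki) = (K * Ki) * (Uᵀ * (M * (U * Ki))) := by simp only [Matrix.mul_assoc]
        _ = Uᵀ * (M * (U * Ki)) := by rw [hKKi, Matrix.one_mul]
    · simp only [hS, Matrix.mul_assoc]
  rw [Matrix.mul_add, e1, e2]
  have e3 : Uᵀ * (M * (U * Ki)) - Uᵀ * (S * (M * (U * Ki))) = Uᵀ * (U * Ki) := by
    rw [← Matrix.mul_sub, ← Matrix.mul_assoc S M, ← Matrix.sub_mul, key, Matrix.one_mul]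
  rw [e3, sub_add_cancel]

/-- [folklore] Hence `K − UᵀU` is invertible … -/
theorem isUnit_det_downdate (K : Matrix ι ι 𝕜) (U : Matrix κ ι 𝕜) (hK : IsUnit K.det) (hM : IsUnit (1 - U * K⁻¹ * Uᵀ).det) :
    IsUnit (K - Uᵀ * U).det :=
  Matrix.isUnit_det_of_right_inverse (woodbury_downdate_mul K U hK hM)

/-- [folklore] … with inverse `(K − UᵀU)⁻¹ = K⁻¹ + K⁻¹Uᵀ(1 − UK⁻¹Uᵀ)⁻¹UK⁻¹`. -/
theorem inv_downdate (K : Matrix ι ι 𝕜) (U : Matrix κ ι 𝕜) (hK : IsUnit K.det) (hM : IsUnit (1 - U * K⁻¹ * Uᵀ).det) :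
    (K - Uᵀ * U)⁻¹ = K⁻¹ + K⁻¹ * Uᵀ * (1 - U * K⁻¹ * Uᵀ)⁻¹ * U * K⁻¹ :=
  Matrix.inv_eq_right_inv (woodbury_downdate_mul K U hK hM)

/-- [folklore] **WOODBURY, UPDATE FORM (right inverse)**: `(K + UᵀU)·(K⁻¹ − K⁻¹Uᵀ(1 + UK⁻¹Uᵀ)⁻¹UK⁻¹) = 1`. -/
theorem woodbury_update_mul (K : Matrix ι ι 𝕜) (U : Matrix κ ι 𝕜) (hK : IsUnit K.det)
    (hM : IsUnit (1 + U * K⁻¹ * Uᵀ).det) :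
    (K + Uᵀ * U) * (K⁻¹ - K⁻¹ * Uᵀ * (1 + U * K⁻¹ * Uᵀ)⁻¹ * U * K⁻¹) = 1 := by
  set Ki := K⁻¹ with hKi
  set S : Matrix κ κ 𝕜 := U * Ki * Uᵀ with hS
  set M : Matrix κ κ 𝕜 := (1 + S)⁻¹ with hMdef
  have hKKi : K * Ki = 1 := Matrix.mul_nonsing_inv K hK
  have hSM : (1 + S) * M = 1 := Matrix.mul_nonsing_inv _ hM
  have key : M + S * M = 1 := by rw [← hSM, Matrix.add_mul, Matrix.one_mul]
  have e1 : (K + Uᵀ * U) * Ki = 1 + Uᵀ * (U * Ki) := by rw [Matrix.add_mul, hKKi, Matrix.mul_assoc]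
  have e2 : (K + Uᵀ * U) * (Ki * Uᵀ * M * U * Ki) = Uᵀ * (M * (U * Ki)) + Uᵀ * (S * (M * (U * Ki))) := by
    rw [Matrix.add_mul]
    congr 1
    · calc K * (Ki * Uᵀ * M * U * Ki) = (K * Ki) * (Uᵀ * (M * (U * Ki))) := by simp only [Matrix.mul_assoc]
        _ = Uᵀ * (M * (U * Ki)) := by rw [hKKi, Matrix.one_mul]
    · simp only [hS, Matrix.mul_assoc]
  rw [Matrix.mul_sub, e1, e2]
  have e3 : Uᵀ * (M * (U * Ki)) + Uᵀ * (S * (M * (U * Ki))) = Uᵀ * (U * Ki) := by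
    rw [← Matrix.mul_add, ← Matrix.mul_assoc S M, ← Matrix.add_mul, key, Matrix.one_mul]
  rw [e3, add_sub_cancel_right]

/-- [folklore] Update form: `K + UᵀU` is invertible with `(K + UᵀU)⁻¹ = K⁻¹ − K⁻¹Uᵀ(1 + UK⁻¹Uᵀ)⁻¹UK⁻¹`. -/
theorem inv_update (K : Matrix ι ι 𝕜) (U : Matrix κ ι 𝕜) (hK : IsUnit K.det) (hM : IsUnit (1 + U * K⁻¹ * Uᵀ).det) :
    IsUnit (K + Uᵀ * U).det ∧ (K + Uᵀ * U)⁻¹ = K⁻¹ - K⁻¹ * Uᵀ * (1 + U * K⁻¹ * Uᵀ)⁻¹ * U * K⁻¹ :=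
  ⟨Matrix.isUnit_det_of_right_inverse (woodbury_update_mul K U hK hM), Matrix.inv_eq_right_inv (woodbury_update_mul K U hK hM)⟩

/-! ## §2 The bordered application: `K := kkt H Q`, `Û := fromCols E 0` -/

omit [Fintype ν] [Fintype μ] [DecidableEq κ] [DecidableEq ν] [DecidableEq μ] in
/-- [folklore] The bordered matrix of the downdated form is the downdate of the bordered matrix by the LIFT `Û := fromCols E 0`:
`kkt (H − EᵀE) Q = kkt H Q − ÛᵀÛ`. -/
theorem kkt_downdate_eq (H : Matrix ν ν 𝕜) (Q : Matrix μ ν 𝕜) (E : Matrix κ ν 𝕜) :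
    kkt (H - Eᵀ * E) Q = kkt H Q - (fromCols E (0 : Matrix κ μ 𝕜))ᵀ * fromCols E (0 : Matrix κ μ 𝕜) := by
  rw [transpose_fromCols, fromRows_mul_fromCols, kkt_eq_fromBlocks, kkt_eq_fromBlocks]
  ext (i | i) (j | j) <;> simp [fromBlocks]

omit [Fintype κ] [DecidableEq κ] in
/-- [folklore] `Û·(kkt H Q)⁻¹·Ûᵀ = E·flucCov H Q·Eᵀ` — the lift only sees the `₁₁` block. -/
theorem lift_mul_kktInv_mul_lift_transpose (H : Matrix ν ν 𝕜) (Q : Matrix μ ν 𝕜) (E : Matrix κ ν 𝕜) :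
    fromCols E (0 : Matrix κ μ 𝕜) * (kkt H Q)⁻¹ * (fromCols E (0 : Matrix κ μ 𝕜))ᵀ = E * flucCov H Q * Eᵀ := by
  rw [kktInv_eq_fromBlocks, fromCols_mul_fromBlocks, transpose_fromCols, fromCols_mul_fromRows]
  simp

omit [Fintype κ] [DecidableEq κ] in
/-- [folklore] `Û·(kkt H Q)⁻¹ = fromCols (E·𝒢) (E·ℋ)` and `(kkt H Q)⁻¹·Ûᵀ = fromRows (𝒢·Eᵀ) (ℋᴸ·Eᵀ)`. -/
theorem lift_mul_kktInv (H : Matrix ν ν 𝕜) (Q : Matrix μ ν 𝕜) (E : Matrix κ ν 𝕜) :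
    fromCols E (0 : Matrix κ μ 𝕜) * (kkt H Q)⁻¹ = fromCols (E * flucCov H Q) (E * minOp H Q)
      ∧ (kkt H Q)⁻¹ * (fromCols E (0 : Matrix κ μ 𝕜))ᵀ = fromRows (flucCov H Q * Eᵀ) (minOpL H Q * Eᵀ) := by
  constructor
  · rw [kktInv_eq_fromBlocks, fromCols_mul_fromBlocks]; simp
  · rw [kktInv_eq_fromBlocks, transpose_fromCols, fromBlocks_mul_fromRows]; simp

/-- [folklore] **INVERTIBILITY OF THE DOWNDATED BORDERED MATRIX**: `IsUnit (kkt H Q).det` and `IsUnit (1 − E·flucCov H Q·Eᵀ).det` ⟹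
`IsUnit (kkt (H − EᵀE) Q).det` — no invertibility of `H` is assumed. -/
theorem isUnit_det_kkt_downdate (H : Matrix ν ν 𝕜) (Q : Matrix μ ν 𝕜) (E : Matrix κ ν 𝕜) (h : IsUnit (kkt H Q).det)
    (hM : IsUnit (1 - E * flucCov H Q * Eᵀ).det) : IsUnit (kkt (H - Eᵀ * E) Q).det := by
  rw [kkt_downdate_eq]
  refine isUnit_det_downdate _ _ h ?_
  rw [lift_mul_kktInv_mul_lift_transpose]; exact hM

/-- [folklore] The full bordered inverse after the downdate. -/
theorem kktInv_downdate (H : Matrix ν ν 𝕜) (Q : Matrix μ ν 𝕜) (E : Matrix κ ν 𝕜) (h : IsUnit (kkt H Q).det)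
    (hM : IsUnit (1 - E * flucCov H Q * Eᵀ).det) :
    (kkt (H - Eᵀ * E) Q)⁻¹ = (kkt H Q)⁻¹
      + fromRows (flucCov H Q * Eᵀ) (minOpL H Q * Eᵀ) * (1 - E * flucCov H Q * Eᵀ)⁻¹ * fromCols (E * flucCov H Q) (E * minOp H Q) := by
  have hM' : IsUnit (1 - fromCols E (0 : Matrix κ μ 𝕜) * (kkt H Q)⁻¹ * (fromCols E (0 : Matrix κ μ 𝕜))ᵀ).det := by
    rw [lift_mul_kktInv_mul_lift_transpose]; exact hM
  rw [kkt_downdate_eq, inv_downdate _ _ h hM', lift_mul_kktInv_mul_lift_transpose, Matrix.mul_assoc (kkt H Q)⁻¹,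
    ← (lift_mul_kktInv H Q E).2, Matrix.mul_assoc _ (fromCols E 0), (lift_mul_kktInv H Q E).1]
  simp only [Matrix.mul_assoc]

/-- [folklore] **THE CONSTRAINED WOODBURY FORMULA**: with `Γ₀ := flucCov H Q` and `M := (1 − E·Γ₀·Eᵀ)⁻¹`,
`flucCov (H − EᵀE) Q = Γ₀ + Γ₀·Eᵀ·M·E·Γ₀`. -/
theorem flucCov_downdate (H : Matrix ν ν 𝕜) (Q : Matrix μ ν 𝕜) (E : Matrix κ ν 𝕜) (h : IsUnit (kkt H Q).det)
    (hM : IsUnit (1 - E * flucCov H Q * Eᵀ).det) :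
    flucCov (H - Eᵀ * E) Q = flucCov H Q + flucCov H Q * Eᵀ * (1 - E * flucCov H Q * Eᵀ)⁻¹ * E * flucCov H Q := by
  have hX := kktInv_downdate H Q E h hM
  rw [fromRows_mul, fromRows_mul_fromCols] at hX
  have h11 := congrArg Matrix.toBlocks₁₁ hX
  have hadd : ∀ (A B : Matrix (ν ⊕ μ) (ν ⊕ μ) 𝕜), (A + B).toBlocks₁₁ = A.toBlocks₁₁ + B.toBlocks₁₁ := fun A B => rfl
  rw [hadd, toBlocks_fromBlocks₁₁] at h11
  show ((kkt (H - Eᵀ * E) Q)⁻¹).toBlocks₁₁ = ((kkt H Q)⁻¹).toBlocks₁₁ + _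
  rw [h11]
  simp only [flucCov, Matrix.mul_assoc]

/-- [folklore] **THE MINIMISER AFTER THE DOWNDATE**: `minOp (H − EᵀE) Q = ℋ + Γ₀·Eᵀ·M·E·ℋ` (`ℋ = minOp H Q`). -/
theorem minOp_downdate (H : Matrix ν ν 𝕜) (Q : Matrix μ ν 𝕜) (E : Matrix κ ν 𝕜) (h : IsUnit (kkt H Q).det)
    (hM : IsUnit (1 - E * flucCov H Q * Eᵀ).det) :
    minOp (H - Eᵀ * E) Q = minOp H Q + flucCov H Q * Eᵀ * (1 - E * flucCov H Q * Eᵀ)⁻¹ * E * minOp H Q := by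
  have hX := kktInv_downdate H Q E h hM
  rw [fromRows_mul, fromRows_mul_fromCols] at hX
  have h12 := congrArg Matrix.toBlocks₁₂ hX
  have hadd : ∀ (A B : Matrix (ν ⊕ μ) (ν ⊕ μ) 𝕜), (A + B).toBlocks₁₂ = A.toBlocks₁₂ + B.toBlocks₁₂ := fun A B => rfl
  rw [hadd, toBlocks_fromBlocks₁₂] at h12
  show ((kkt (H - Eᵀ * E) Q)⁻¹).toBlocks₁₂ = ((kkt H Q)⁻¹).toBlocks₁₂ + _
  rw [h12]
  simp only [flucCov, minOp, Matrix.mul_assoc]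

/-- [folklore] The downdated covariance is still constrained: `Q·flucCov (H − EᵀE) Q = 0` and `flucCov (H − EᵀE) Q·Qᵀ = 0`. -/
theorem mul_flucCov_downdate (H : Matrix ν ν 𝕜) (Q : Matrix μ ν 𝕜) (E : Matrix κ ν 𝕜) (h : IsUnit (kkt H Q).det)
    (hM : IsUnit (1 - E * flucCov H Q * Eᵀ).det) :
    Q * flucCov (H - Eᵀ * E) Q = 0 ∧ flucCov (H - Eᵀ * E) Q * Qᵀ = 0 :=
  ⟨mul_flucCov _ Q (isUnit_det_kkt_downdate H Q E h hM), flucCov_mul_transpose _ Q (isUnit_det_kkt_downdate H Q E h hM)⟩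

/-- [folklore] For SYMMETRIC `H` the bordered matrix is symmetric, hence so are its inverse and the `₁₁` block `flucCov H Q`. -/
theorem flucCov_transpose_of_symm (H : Matrix ν ν 𝕜) (Q : Matrix μ ν 𝕜) (hH : Hᵀ = H) : (flucCov H Q)ᵀ = flucCov H Q := by
  have hK : (kkt H Q)ᵀ = kkt H Q := by rw [kkt_eq_fromBlocks, fromBlocks_transpose, hH, transpose_transpose, transpose_zero]
  have hKi : ((kkt H Q)⁻¹)ᵀ = (kkt H Q)⁻¹ := by rw [transpose_nonsing_inv, hK]
  unfold flucCov
  ext i j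
  have := congrFun (congrFun hKi (Sum.inl i)) (Sum.inl j)
  simpa [toBlocks₁₁, transpose_apply] using this

omit [DecidableEq κ] in
/-- [folklore] **SYMMETRY OF THE DOWNDATED COVARIANCE** for symmetric `H`: `(flucCov (H − EᵀE) Q)ᵀ = flucCov (H − EᵀE) Q`. -/
theorem flucCov_downdate_transpose (H : Matrix ν ν 𝕜) (Q : Matrix μ ν 𝕜) (E : Matrix κ ν 𝕜) (hH : Hᵀ = H) :
    (flucCov (H - Eᵀ * E) Q)ᵀ = flucCov (H - Eᵀ * E) Q :=
  flucCov_transpose_of_symm _ Q (by rw [transpose_sub, transpose_mul, transpose_transpose, hH])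

/-- [folklore] **THE SAME IN THE `constrProp` DICTIONARY** (invertible `H` with invertible `Q H⁻¹ Qᵀ`, e.g. R-FP-17's unconstrained BF-Feynman
form): with `Γ₀ = H⁻¹ − H⁻¹Qᵀ(QH⁻¹Qᵀ)⁻¹QH⁻¹ = constrProp H Q`,
`flucCov (H − EᵀE) Q = Γ₀ + Γ₀·Eᵀ·(1 − E·Γ₀·Eᵀ)⁻¹·E·Γ₀`. -/
theorem flucCov_downdate_eq_constrProp (H : Matrix ν ν 𝕜) (Q : Matrix μ ν 𝕜) (E : Matrix κ ν 𝕜) (hH : IsUnit H.det)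
    (hP : IsUnit (blockProp H Q).det) (hM : IsUnit (1 - E * constrProp H Q * Eᵀ).det) :
    flucCov (H - Eᵀ * E) Q
      = constrProp H Q + constrProp H Q * Eᵀ * (1 - E * constrProp H Q * Eᵀ)⁻¹ * E * constrProp H Q := by
  have hk : IsUnit (kkt H Q).det := isUnit_iff_ne_zero.mpr (det_kkt_ne_zero H Q hH hP)
  have hG : flucCov H Q = constrProp H Q := flucCov_eq_constrProp H Q hH hP
  rw [← hG] at hM ⊢
  exact flucCov_downdate H Q E hk hM

/-- [folklore] **THE UPDATE SIGN** (adding a positive weight `EᵀE` to the fine form, e.g. an inner gauge-fixing weight `τᵀτ`): under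
`IsUnit (kkt H Q).det` and `IsUnit (1 + E·Γ₀·Eᵀ).det`, `kkt (H + EᵀE) Q` is invertible and
`flucCov (H + EᵀE) Q = Γ₀ − Γ₀·Eᵀ·(1 + E·Γ₀·Eᵀ)⁻¹·E·Γ₀` — the covariance DEcreases by a Woodbury remainder. -/
theorem flucCov_update (H : Matrix ν ν 𝕜) (Q : Matrix μ ν 𝕜) (E : Matrix κ ν 𝕜) (h : IsUnit (kkt H Q).det)
    (hM : IsUnit (1 + E * flucCov H Q * Eᵀ).det) :
    IsUnit (kkt (H + Eᵀ * E) Q).det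
      ∧ flucCov (H + Eᵀ * E) Q = flucCov H Q - flucCov H Q * Eᵀ * (1 + E * flucCov H Q * Eᵀ)⁻¹ * E * flucCov H Q := by
  have hK : kkt (H + Eᵀ * E) Q = kkt H Q + (fromCols E (0 : Matrix κ μ 𝕜))ᵀ * fromCols E (0 : Matrix κ μ 𝕜) := by
    rw [transpose_fromCols, fromRows_mul_fromCols, kkt_eq_fromBlocks, kkt_eq_fromBlocks]
    ext (i | i) (j | j) <;> simp [fromBlocks]
  have hM' : IsUnit (1 + fromCols E (0 : Matrix κ μ 𝕜) * (kkt H Q)⁻¹ * (fromCols E (0 : Matrix κ μ 𝕜))ᵀ).det := by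
    rw [lift_mul_kktInv_mul_lift_transpose]; exact hM
  obtain ⟨hU, hX⟩ := inv_update _ _ h hM'
  rw [← hK] at hU hX
  refine ⟨hU, ?_⟩
  rw [lift_mul_kktInv_mul_lift_transpose] at hX
  simp only [Matrix.mul_assoc] at hX
  rw [(lift_mul_kktInv H Q E).1, ← Matrix.mul_assoc (kkt H Q)⁻¹, (lift_mul_kktInv H Q E).2, Matrix.mul_fromCols,
    fromRows_mul_fromCols] at hX
  have h11 := congrArg Matrix.toBlocks₁₁ hX
  have hsub : ∀ (A B : Matrix (ν ⊕ μ) (ν ⊕ μ) 𝕜), (A - B).toBlocks₁₁ = A.toBlocks₁₁ - B.toBlocks₁₁ := fun A B => rfl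
  rw [hsub, toBlocks_fromBlocks₁₁] at h11
  show ((kkt (H + Eᵀ * E) Q)⁻¹).toBlocks₁₁ = ((kkt H Q)⁻¹).toBlocks₁₁ - _
  rw [h11]
  simp only [flucCov, Matrix.mul_assoc]

/-! ## §3 Two stages -/

/-- [folklore] **TWO-STAGE WOODBURY** (R-FP-17 (H′2): first the constraint-type deficit `E₁`, then the ghost-type deficit `E₂`): with
`Γ₀ := flucCov H Q`, `M₁ := (1 − E₁Γ₀E₁ᵀ)⁻¹`, `Γ₁ := Γ₀ + Γ₀E₁ᵀM₁E₁Γ₀`, `M₂ := (1 − E₂Γ₁E₂ᵀ)⁻¹`: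
`kkt (H − E₁ᵀE₁ − E₂ᵀE₂) Q` is invertible and `flucCov (H − E₁ᵀE₁ − E₂ᵀE₂) Q = Γ₁ + Γ₁E₂ᵀM₂E₂Γ₁`. -/
theorem flucCov_downdate_twice {κ' : Type*} [Fintype κ'] [DecidableEq κ'] (H : Matrix ν ν 𝕜) (Q : Matrix μ ν 𝕜)
    (E₁ : Matrix κ ν 𝕜) (E₂ : Matrix κ' ν 𝕜) (h : IsUnit (kkt H Q).det) (hM₁ : IsUnit (1 - E₁ * flucCov H Q * E₁ᵀ).det)
    (hM₂ : IsUnit (1 - E₂ * flucCov (H - E₁ᵀ * E₁) Q * E₂ᵀ).det) :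
    IsUnit (kkt (H - E₁ᵀ * E₁ - E₂ᵀ * E₂) Q).det
      ∧ flucCov (H - E₁ᵀ * E₁ - E₂ᵀ * E₂) Q
          = flucCov (H - E₁ᵀ * E₁) Q
            + flucCov (H - E₁ᵀ * E₁) Q * E₂ᵀ * (1 - E₂ * flucCov (H - E₁ᵀ * E₁) Q * E₂ᵀ)⁻¹ * E₂ * flucCov (H - E₁ᵀ * E₁) Q
      ∧ flucCov (H - E₁ᵀ * E₁) Q = flucCov H Q + flucCov H Q * E₁ᵀ * (1 - E₁ * flucCov H Q * E₁ᵀ)⁻¹ * E₁ * flucCov H Q := by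
  have h₁ := isUnit_det_kkt_downdate H Q E₁ h hM₁
  exact ⟨isUnit_det_kkt_downdate _ Q E₂ h₁ hM₂, flucCov_downdate _ Q E₂ h₁ hM₂, flucCov_downdate H Q E₁ h hM₁⟩

end Summit.QuantumFields.BalabanUV.Beta.FP.ConstrainedWoodbury
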